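import Summits.BirchSwinnertonDyer.BirchSwinnertonDyer.Theorems.SignedLowerHalvesSmallImageLowerHalfBothSignsRttD2SeqLocalCondition
import Summits.BirchSwinnertonDyer.BirchSwinnertonDyer.Theorems.SignedLowerHalvesSmallImageLowerHalfBothSignsRttD2SeqJ3TowerPairing
import Summits.BirchSwinnertonDyer.Rank1Residual.Additive.StrictSignedSelmerInftyLocal
import Literature.NumberTheory.EllipticCurves.IwasawaSelmerProofs
import HarnessLib

/-!
# Route `SignedLowerHalves`, crux L `SmallImageLowerHalfBothSigns` (stmt-BirchSwinnertonDyer-23599), line `rtt_w3` v16–v20 — E2, row J3 residual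
# (`hsolL`), brick H5a: CONTROL IN THE LOCAL TOWER — the layer conditions `E^ε_{sat}(K_n·K_v)` are monotone in `n`, `E^ε_{sat,v,0}` is their DIRECTED union, and a
# layer class whose image at the top of the tower lies in `E^ε_{sat,v}` satisfies, together with ALL its `Γ_{K_v}`-conjugates, the layer condition at ONE deeper layer

WIDTH seat `bsd-line-slh-p3-w3` g24 under LEAD `cruxlead-stmt-BirchSwinnertonDyer-23599` g12 (cell `bsd-ssimc`); helper `--supports stmt-BirchSwinnertonDyer-23599`.
THEOREMS ONLY (no definition, no named fact, no instance, no `sorry`). HONEST FRAMING: cohomological bookkeeping for the layer-orthogonality input `horth` of H7a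
(`exists_mem_strictLevel_locPairNK_eq_of_orth`, p800127): Kobayashi's monotonicity `E^ε(K_{n,v}) ⊆ E^ε(K_{n′,v})` (tree `signedLocalPointsOfEmb_mono`) transported to the
saturated cocycle conditions, and the injectivity half of Serre's exhaustion `H¹(U_∞, M) = lim→ H¹(U_n, M)` (g22 `exists_resOfLe_layer_eq_resOfLe_layer`) in place of an
inflation–restriction control hypothesis — NO hypothesis on `M^{U_∞}` is needed. Nothing about any curve; E2, crux L, crux M, BSD remain OPEN and are proved for NO curve.

* `comp_inclusion_mem_localSatGen`, `comp_inclusion_mem_closure_localSatGen` — the saturated generators / their span restrict along `U_{n′,v} ≤ U_{n,v}`;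
* ★ `resOfLe_mem_localCondLayerSat` — `res_{n→n′} E^ε_{sat}(K_n·K_v) ⊆ E^ε_{sat}(K_{n′}·K_v)`; `monotone_map_resOfLe_localCondLayerSat`, `mem_localCondInftySat₀_iff_exists`;
* ★ `exists_forall_resOfLe_mem_localCondLayerSat` — `res_{m→∞} ℓ ∈ E^ε_{sat,v,0} ⇒ res_{m→n} ℓ ∈ E^ε_{sat}(K_n·K_v)` for all large `n`;
* ★★ `exists_forall_resOfLe_conjH1_mem_localCondLayerSat` — `res_{m→∞} ℓ ∈ E^ε_{sat,v} ⇒ ∃ N ≥ m, ∀ σ ∈ Γ_{K_v}, res_{m→N}(conj_σ ℓ) ∈ E^ε_{sat}(K_N·K_v)` (finitely many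
  conjugates modulo `U_{m,v}`).
References: [Kobayashi2003] Def. 1.1, Prop. 8.12, Thm. 7.3 i); [SerreGaloisCohomology1997] I §2.2 Prop. 8, I §5.1; [Rubin2000] §4.2, App. B.2; [HatleyLeiVigni2022] (3.1).
-/

set_option autoImplicit false
set_option linter.dupNamespace false -- D-0017: single-problem summit, the namespace repeats the problem name by design
noncomputable section

open scoped Classical
open NumberField IsDedekindDomain Field CategoryTheory Function

namespace Summit.BirchSwinnertonDyer.BirchSwinnertonDyer.Theorems.SmallImageRttD2Seq

open Literature.NumberTheory.EllipticCurves Literature.NumberTheory.EllipticCurves.Kobayashi2003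
  Literature.NumberTheory.EllipticCurves.GreenbergVatsal2000 Literature.NumberTheory.GaloisRepresentations
  Summit.BirchSwinnertonDyer.BirchSwinnertonDyer.Theorems.SmallImageCharSignedSelmer

section Generic

variable {G : Type} [Group G] [TopologicalSpace G] [IsTopologicalGroup G]
  {A : Type} [AddCommGroup A] [DistribMulAction G A] [TopologicalSpace A] [DiscreteTopology A]

/-- `res_{H₁ ≤ H₂} [φ] = [φ ∘ incl]` on explicit cocycles, in the `∃`-form used below (generic topological group; `map_oneCocycleClass`).
[cite: SerreGaloisCohomology1997, I §2.4] -/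
theorem exists_resOfLe_oneCocycleClass_eq {H₁ H₂ : Subgroup G} (hle : H₁ ≤ H₂) (φ : contOneCocycles (discreteTopRep H₂ A)) :
    ∃ φ' : contOneCocycles (discreteTopRep H₁ A), resOfLe A hle (oneCocycleClass _ φ) = oneCocycleClass _ φ' ∧
      (⇑φ'.1 : H₁ → A) = fun x ↦ φ.1 (Subgroup.inclusion hle x) :=
  ⟨_, map_oneCocycleClass _ _ _ φ, funext fun _ ↦ rfl⟩

end Generic

section Local

variable {K : Type} [Field K] [NumberField K] {p : ℕ} [Fact p.Prime] (κ : ZpExtension K p)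
  (M : Type) [AddCommGroup M] [TopologicalSpace M] [DiscreteTopology M]
  (R : Type*) [Ring R] [Module R M]
  (V : WeierstrassCurve K) (j : V.geomPrimaryTorsion p →+ M) (ε : ℤˣ)
  (v : HeightOneSpectrum (𝓞 K)) [DistribMulAction (absoluteGaloisGroup (v.adicCompletion K)) M]

/-! ## §1. The layer conditions are monotone in the layer -/

omit [DistribMulAction (absoluteGaloisGroup (v.adicCompletion K)) M] [TopologicalSpace M] [DiscreteTopology M] in
variable {κ M R V j ε v} in
/-- A saturated generator `τ ↦ r · j(t_Q τ)` on `U_{n,v}` (`pᵏQ ∈ E^ε(K_n·K_v)`) restricts along `U_{n′,v} ≤ U_{n,v}` to a saturated generator on `U_{n′,v}` — the same `r`, `Q`, `k`,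
with `E^ε(K_n·K_v) ⊆ E^ε(K_{n′}·K_v)` (tree `signedLocalPointsOfEmb_mono`, Kobayashi Prop. 8.12). [cite: Kobayashi2003, Def. 1.1, Prop. 8.12] -/
theorem comp_inclusion_mem_localSatGen {n n' : ℕ} (hn : n ≤ n')
    {f : localSubgroupOfEmb (κ.layerSubgroup n) (closureEmb (K := K) (v.adicCompletion K)) → M}
    (hf : f ∈ localSatGen V p (κ.layerSubgroup n) (closureEmb (K := K) (v.adicCompletion K)) M R j (signedLocalPoints κ (v.adicCompletion K) V ε n)) :
    (fun τ ↦ f (Subgroup.inclusion (localSubgroupOfEmb_layerSubgroup_antitone κ v hn) τ)) ∈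
      localSatGen V p (κ.layerSubgroup n') (closureEmb (K := K) (v.adicCompletion K)) M R j (signedLocalPoints κ (v.adicCompletion K) V ε n') := by
  obtain ⟨r, Q, k, t, hA, ht, hf⟩ := hf
  have hA' : (p ^ k) • Q ∈ signedLocalPoints κ (v.adicCompletion K) V ε n' :=
    Summit.BirchSwinnertonDyer.Rank1Residual.Additive.signedLocalPointsOfEmb_mono κ (closureEmb (K := K) (v.adicCompletion K)) V ε hn hA
  have ht' : ∀ τ : localSubgroupOfEmb (κ.layerSubgroup n') (closureEmb (K := K) (v.adicCompletion K)),
      pointsMapOfEmb V (closureEmb (K := K) (v.adicCompletion K))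
          ((t (Subgroup.inclusion (localSubgroupOfEmb_layerSubgroup_antitone κ v hn) τ) : V.geomPrimaryTorsion p) : V.geomPoints) =
        (τ : absoluteGaloisGroup (v.adicCompletion K)) • Q - Q := by
    intro τ
    have e : ((Subgroup.inclusion (localSubgroupOfEmb_layerSubgroup_antitone κ v hn) τ :
        localSubgroupOfEmb (κ.layerSubgroup n) (closureEmb (K := K) (v.adicCompletion K))) : absoluteGaloisGroup (v.adicCompletion K)) =
        (τ : absoluteGaloisGroup (v.adicCompletion K)) := Subgroup.coe_inclusion _ _
    rw [← e]
    exact ht _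
  have hf' : (fun τ ↦ f (Subgroup.inclusion (localSubgroupOfEmb_layerSubgroup_antitone κ v hn) τ)) =
      fun τ ↦ r • j (t (Subgroup.inclusion (localSubgroupOfEmb_layerSubgroup_antitone κ v hn) τ)) := by
    funext τ; rw [hf]
  exact ⟨r, Q, k, fun τ ↦ t (Subgroup.inclusion (localSubgroupOfEmb_layerSubgroup_antitone κ v hn) τ), hA', ht', hf'⟩


omit [DistribMulAction (absoluteGaloisGroup (v.adicCompletion K)) M] [TopologicalSpace M] [DiscreteTopology M] in
variable {κ M R V j ε v} in
/-- The span of the saturated generators restricts along `U_{n′,v} ≤ U_{n,v}` into the span at layer `n′`. [cite: Kobayashi2003, Def. 1.1, Prop. 8.12] -/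
theorem comp_inclusion_mem_closure_localSatGen {n n' : ℕ} (hn : n ≤ n')
    {f : localSubgroupOfEmb (κ.layerSubgroup n) (closureEmb (K := K) (v.adicCompletion K)) → M}
    (hf : f ∈ AddSubgroup.closure
      (localSatGen V p (κ.layerSubgroup n) (closureEmb (K := K) (v.adicCompletion K)) M R j (signedLocalPoints κ (v.adicCompletion K) V ε n))) :
    (fun τ ↦ f (Subgroup.inclusion (localSubgroupOfEmb_layerSubgroup_antitone κ v hn) τ)) ∈
      AddSubgroup.closure
        (localSatGen V p (κ.layerSubgroup n') (closureEmb (K := K) (v.adicCompletion K)) M R j (signedLocalPoints κ (v.adicCompletion K) V ε n')) := by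
  refine AddSubgroup.closure_induction
    (p := fun f _ ↦ (fun τ ↦ f (Subgroup.inclusion (localSubgroupOfEmb_layerSubgroup_antitone κ v hn) τ)) ∈
      AddSubgroup.closure
        (localSatGen V p (κ.layerSubgroup n') (closureEmb (K := K) (v.adicCompletion K)) M R j (signedLocalPoints κ (v.adicCompletion K) V ε n')))
    (fun f hf ↦ AddSubgroup.subset_closure (comp_inclusion_mem_localSatGen hn hf)) ?_ ?_ ?_ hf
  · exact zero_mem _
  · intro f g _ _ hf hg
    exact add_mem hf hg
  · intro f _ hf
    exact neg_mem hf

variable {κ M R V j ε v} in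
/-- ★ **`res_{n→n′} E^ε_{sat}(K_n·K_v) ⊆ E^ε_{sat}(K_{n′}·K_v)` for `n ≤ n′`**: the layer conditions are MONOTONE in the layer (a representing cocycle restricts, as a function,
into the span of the restricted generators). [cite: Kobayashi2003, Def. 1.1, Prop. 8.12] -/
theorem resOfLe_mem_localCondLayerSat {n n' : ℕ} (hn : n ≤ n')
    {c : subgroupH1 (localSubgroupOfEmb (κ.layerSubgroup n) (closureEmb (K := K) (v.adicCompletion K))) M} (hc : c ∈ localCondLayerSat κ M R V j ε v n) :
    resOfLe M (localSubgroupOfEmb_layerSubgroup_antitone κ v hn) c ∈ localCondLayerSat κ M R V j ε v n' := by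
  obtain ⟨φ, rfl, hφ⟩ := hc
  obtain ⟨φ', hφ', hfun⟩ := exists_resOfLe_oneCocycleClass_eq (localSubgroupOfEmb_layerSubgroup_antitone κ v hn) φ
  exact ⟨φ', hφ'.symm, hfun ▸ comp_inclusion_mem_closure_localSatGen hn hφ⟩

/-- The images `res_{n→∞} E^ε_{sat}(K_n·K_v) ≤ H¹(U_∞, M)` increase with `n`. [cite: Kobayashi2003, Def. 1.1] [cite: SerreGaloisCohomology1997, I §2.2] -/
theorem monotone_map_resOfLe_localCondLayerSat :
    Monotone fun n : ℕ ↦ (localCondLayerSat κ M R V j ε v n).map (resOfLe M (localSubgroupOfEmb_kerSubgroup_le κ v n)) := by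
  intro n n' hn
  rintro _ ⟨c, hc, rfl⟩
  refine ⟨resOfLe M (localSubgroupOfEmb_layerSubgroup_antitone κ v hn) c, resOfLe_mem_localCondLayerSat hn hc, ?_⟩
  rw [← AddMonoidHom.comp_apply, resOfLe_comp_holds]

variable {κ M R V j ε v} in
/-- **`E^ε_{sat,v,0}` is a DIRECTED union**: `c ∈ E^ε_{sat,v,0}` iff `c = res_{n→∞} d` for some layer `n` and some `d ∈ E^ε_{sat}(K_n·K_v)`.
[cite: Kobayashi2003, Def. 1.1] [cite: HatleyLeiVigni2022, (3.1)] -/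
theorem mem_localCondInftySat₀_iff_exists (c : subgroupH1 (localSubgroupOfEmb κ.kerSubgroup (closureEmb (K := K) (v.adicCompletion K))) M) :
    c ∈ localCondInftySat₀ κ M R V j ε v ↔
      ∃ (n : ℕ) (d : subgroupH1 (localSubgroupOfEmb (κ.layerSubgroup n) (closureEmb (K := K) (v.adicCompletion K))) M),
        d ∈ localCondLayerSat κ M R V j ε v n ∧ resOfLe M (localSubgroupOfEmb_kerSubgroup_le κ v n) d = c := by
  rw [localCondInftySat₀, AddSubgroup.mem_iSup_of_directed (monotone_map_resOfLe_localCondLayerSat κ M R V j ε v).directed_le]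
  constructor
  · rintro ⟨n, d, hd, hdc⟩
    exact ⟨n, d, hd, hdc⟩
  · rintro ⟨n, d, hd, hdc⟩
    exact ⟨n, d, hd, hdc⟩

/-! ## §2. Control: from the top of the tower back to a layer -/

variable {κ M R V j ε v} in
/-- ★ **From `E^ε_{sat,v,0}` back to a layer.** If `res_{m→∞} ℓ ∈ E^ε_{sat,v,0}` for a layer class `ℓ ∈ H¹(U_{m,v}, M)` (`M` with open stabilisers), then
`res_{m→n} ℓ ∈ E^ε_{sat}(K_n·K_v)` for ALL large `n`: `res_{m→∞} ℓ = res_{n₀→∞} d` with `d ∈ E^ε_{sat}(K_{n₀}·K_v)` (directed union), the two layer classes agree on a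
deeper layer (injectivity half of exhaustion, `exists_resOfLe_layer_eq_resOfLe_layer`), and the layer conditions are monotone. No hypothesis on `M^{U_∞}` is used.
[cite: SerreGaloisCohomology1997, I §2.2 Prop. 8] [cite: Kobayashi2003, Def. 1.1, Prop. 8.12] -/
theorem exists_forall_resOfLe_mem_localCondLayerSat
    (hstab : ∀ m : M, IsOpen (MulAction.stabilizer (absoluteGaloisGroup (v.adicCompletion K)) m : Set (absoluteGaloisGroup (v.adicCompletion K))))
    {m : ℕ} (ℓ : subgroupH1 (localSubgroupOfEmb (κ.layerSubgroup m) (closureEmb (K := K) (v.adicCompletion K))) M)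
    (h : resOfLe M (localSubgroupOfEmb_kerSubgroup_le κ v m) ℓ ∈ localCondInftySat₀ κ M R V j ε v) :
    ∃ (N : ℕ) (hN : m ≤ N), ∀ (n : ℕ) (hn : N ≤ n),
      resOfLe M (localSubgroupOfEmb_layerSubgroup_antitone κ v (hN.trans hn)) ℓ ∈ localCondLayerSat κ M R V j ε v n := by
  obtain ⟨n₀, d, hd, hdeq⟩ := (mem_localCondInftySat₀_iff_exists _).mp h
  obtain ⟨N, hn₀N, hmN, heq⟩ := exists_resOfLe_layer_eq_resOfLe_layer hstab d ℓ hdeq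
  refine ⟨N, hmN, fun n hn ↦ ?_⟩
  have e : resOfLe M (localSubgroupOfEmb_layerSubgroup_antitone κ v (hmN.trans hn)) ℓ =
      resOfLe M (localSubgroupOfEmb_layerSubgroup_antitone κ v hn) (resOfLe M (localSubgroupOfEmb_layerSubgroup_antitone κ v hmN) ℓ) := by
    rw [← AddMonoidHom.comp_apply, resOfLe_comp_holds]
  rw [e, ← heq, ← AddMonoidHom.comp_apply, resOfLe_comp_holds]
  exact resOfLe_mem_localCondLayerSat (hn₀N.trans hn) hd

variable {κ M R V j ε v} in
/-- ★★ **All conjugates at one deeper layer.** If `res_{m→∞} ℓ ∈ E^ε_{sat,v}` (every `Γ_{K_v}`-conjugate in `E^ε_{sat,v,0}`) for `ℓ ∈ H¹(U_{m,v}, M)`, then there is ONE layer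
`N ≥ m` with `res_{m→N}(conj_σ ℓ) ∈ E^ε_{sat}(K_N·K_v)` for EVERY `σ ∈ Γ_{K_v}`: conjugation commutes with restriction (`resOfLe_comp_conjH1`), `conj_σ` on `H¹(U_{m,v}, M)`
depends only on `σ` modulo `U_{m,v}` (inner classes act trivially), and `Γ_{K_v} ⧸ U_{m,v}` is finite. [cite: SerreGaloisCohomology1997, I §2.2 Prop. 8, I §5.1]
[cite: Kobayashi2003, Thm. 7.3 i)] -/
theorem exists_forall_resOfLe_conjH1_mem_localCondLayerSat
    (hstab : ∀ m : M, IsOpen (MulAction.stabilizer (absoluteGaloisGroup (v.adicCompletion K)) m : Set (absoluteGaloisGroup (v.adicCompletion K))))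
    {m : ℕ} (ℓ : subgroupH1 (localSubgroupOfEmb (κ.layerSubgroup m) (closureEmb (K := K) (v.adicCompletion K))) M)
    (h : resOfLe M (localSubgroupOfEmb_kerSubgroup_le κ v m) ℓ ∈ localCondInftySat κ M R V j ε v) :
    haveI := normal_localSubgroupOfEmb_layerSubgroup κ v m
    ∃ (N : ℕ) (hN : m ≤ N), ∀ σ : absoluteGaloisGroup (v.adicCompletion K),
      resOfLe M (localSubgroupOfEmb_layerSubgroup_antitone κ v hN)
        (conjH1 (localSubgroupOfEmb (κ.layerSubgroup m) (closureEmb (K := K) (v.adicCompletion K))) M σ ℓ) ∈ localCondLayerSat κ M R V j ε v N := by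
  haveI := normal_localSubgroupOfEmb_layerSubgroup κ v m
  haveI := normal_localSubgroupOfEmb_kerSubgroup κ v
  haveI : CompactSpace (absoluteGaloisGroup (v.adicCompletion K)) := absoluteGaloisGroup_compactSpace _
  haveI : Finite (absoluteGaloisGroup (v.adicCompletion K) ⧸ localSubgroupOfEmb (κ.layerSubgroup m) (closureEmb (K := K) (v.adicCompletion K))) :=
    Subgroup.quotient_finite_of_isOpen _ (isOpen_localSubgroupOfEmb_layerSubgroup κ v m)
  letI : Fintype (absoluteGaloisGroup (v.adicCompletion K) ⧸ localSubgroupOfEmb (κ.layerSubgroup m) (closureEmb (K := K) (v.adicCompletion K))) :=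
    Fintype.ofFinite _
  -- every conjugate lies in `E^ε_{sat,v,0}` at the top of the tower, hence in the layer conditions from some layer on
  have hconj : ∀ σ : absoluteGaloisGroup (v.adicCompletion K),
      resOfLe M (localSubgroupOfEmb_kerSubgroup_le κ v m)
        (conjH1 (localSubgroupOfEmb (κ.layerSubgroup m) (closureEmb (K := K) (v.adicCompletion K))) M σ ℓ) ∈ localCondInftySat₀ κ M R V j ε v := by
    intro σ
    rw [← AddMonoidHom.comp_apply, resOfLe_comp_conjH1_holds, AddMonoidHom.comp_apply]
    exact (mem_localCondInftySat_iff _).mp h σ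
  choose N hN hmem using fun σ ↦ exists_forall_resOfLe_mem_localCondLayerSat hstab _ (hconj σ)
  -- one layer for the finitely many conjugates modulo `U_{m,v}`
  let Nmax : ℕ := max m (Finset.univ.sup fun x : absoluteGaloisGroup (v.adicCompletion K) ⧸
      localSubgroupOfEmb (κ.layerSubgroup m) (closureEmb (K := K) (v.adicCompletion K)) ↦ N x.out)
  refine ⟨Nmax, le_max_left _ _, fun σ ↦ ?_⟩
  obtain ⟨x, hx⟩ : ∃ x : absoluteGaloisGroup (v.adicCompletion K) ⧸ localSubgroupOfEmb (κ.layerSubgroup m) (closureEmb (K := K) (v.adicCompletion K)),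
      x = (σ : absoluteGaloisGroup (v.adicCompletion K) ⧸ localSubgroupOfEmb (κ.layerSubgroup m) (closureEmb (K := K) (v.adicCompletion K))) := ⟨_, rfl⟩
  have hu : x.out⁻¹ * σ ∈ localSubgroupOfEmb (κ.layerSubgroup m) (closureEmb (K := K) (v.adicCompletion K)) := by
    rw [← QuotientGroup.eq, QuotientGroup.out_eq', hx]
  have hσ : conjH1 (localSubgroupOfEmb (κ.layerSubgroup m) (closureEmb (K := K) (v.adicCompletion K))) M σ ℓ =
      conjH1 (localSubgroupOfEmb (κ.layerSubgroup m) (closureEmb (K := K) (v.adicCompletion K))) M x.out ℓ := by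
    conv_lhs => rw [show σ = x.out * (x.out⁻¹ * σ) by group]
    rw [conjH1_mul_holds, AddMonoidHom.comp_apply, conjH1_of_mem_holds _ M hu, AddMonoidHom.id_apply]
  rw [hσ]
  have hle : N x.out ≤ Nmax :=
    (Finset.le_sup (f := fun y : absoluteGaloisGroup (v.adicCompletion K) ⧸
      localSubgroupOfEmb (κ.layerSubgroup m) (closureEmb (K := K) (v.adicCompletion K)) ↦ N y.out) (Finset.mem_univ x)).trans (le_max_right _ _)
  exact hmem x.out Nmax hle

end Local

end Summit.BirchSwinnertonDyer.BirchSwinnertonDyer.Theorems.SmallImageRttD2Seq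

end
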